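import Summits.ABC.IUTFork.Cor312OrbitCoveringLattices
import HarnessLib

/-!
# [IUTchIII] Cor. 3.12 — the ORBIT-COVERING bed COV, III: the orbit of the Θ-lattice, admissible regions, the log-volume (monotone)

Record-only file (D-0012; MODEL DATA + folklore lemmas, no `Prop` fact, nothing asserted about print) of the abc-iut cell (IUT REPAIR
branch B, sub-cell B3 Joshi, seat abc-iut-rp-j3 gen 3; rung LADDER-ABC:A2.B ⊇ A2.RP). Sequel of `Cor312OrbitCoveringShells` / `…Lattices`
(rank-2 covering shells `covShells` with "Ism" = the lattice automorphisms, coordinates, balls `ball d = p^d·𝓘`, the ANISOTROPIC honestly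
`j²`-volumed Θ-lattice `thetaLat`, the q-ball `qBall`, «every indeterminacy maps every ball onto itself», the killing lemma), imported, not
restated. TAKES NO SIDE on [IUTchIII] Cor. 3.12 or on any author; typed ≠ proved; instantiated ≠ endorsed.

THIS FILE (§10): the INDETERMINACY ORBIT `thetaOrbit` of the Θ-lattice under ⟨(Ind1) ∪ (Ind2)⟩ (`covGroup`); the LOG-VOLUME `covVol`: `−j²` on
the orbit of the Θ-lattice (= minus its AVERAGE DEPTH over the `2^{j+1}` coordinates, `sum_thetaDepth`: the honest normalised covolume of
`q^{j²}·𝓘`), `−d` on the ball `p^d·𝓘`, `0` on the (inadmissible) rest — well-defined because an orbit member that is a ball forces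
`thetaLat = ball j²` (`thetaLat_eq_of_image_eq_ball`, `eq_sq_of_thetaLat_eq_ball`) —; and its MONOTONICITY on the admissible regions (balls
and orbit members; `covVol_mono`, Prop. 3.9 (i)), through the depth comparisons `le_qDepth_of_thetaLat_subset` / `sq_le_of_ball_subset`.
Sequels: `Cor312OrbitCoveringModel` (data, typed Thm. 3.11, setting, pins), `Cor312OrbitCoveringWitness` (covering theorem, honesty vector,
`¬S`, Licence, Statement). HONEST SCOPE: interface-level toy (`l⋇ = 2`, one place, rank 2); standard axioms; nothing asserted.
S. Mochizuki, *Inter-universal Teichmüller theory III*, kurims manuscript (May 2020) = `paper:url-4b091feeb646` (cell render).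
[claim: Mochizuki2012, status: disputed] for every IUT noun.
-/

noncomputable section

open Set

namespace Summit.ABC.IUTFork.Cor312Vol

namespace CoveringWitness

open Thm311 Cor312 Cor312.Checks Cor312.IdentifiedNonVacuity Literature.IUT.LogThetaLattice

variable (p : ℕ) [hp : Fact p.Prime]

/-! ## 10. The orbit of the Θ-lattice, admissible regions, the log-volume -/

/-- ⟨(Ind1) ∪ (Ind2)⟩ of the covering shells (c312-1's `Setting.indGroup` for every situation on `covShells`). [claim: Mochizuki2012, status: disputed] -/
abbrev covGroup : Subgroup covShells.PacketAut := Subgroup.closure (covShells.Ind1Family ∪ covShells.Ind2Family)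

/-- **The INDETERMINACY ORBIT of the Θ-lattice** at `(j, v_ℚ)`: its translates by ⟨(Ind1) ∪ (Ind2)⟩ (these will be the possible images of the
Θ-pilot, part IV). MODEL DATA. [claim: Mochizuki2012, status: disputed] -/
def thetaOrbit (j : toyIndex.Label) (vQ : toyIndex.VQ) : Set (Set (covShells.Packet j vQ)) :=
  {U | ∃ Φ ∈ covGroup, U = Φ j vQ '' thetaLat p j vQ}

omit hp in
/-- The Θ-lattice is in its own orbit. [folklore] -/
theorem thetaLat_mem_thetaOrbit (j : toyIndex.Label) (vQ : toyIndex.VQ) : thetaLat p j vQ ∈ thetaOrbit p j vQ :=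
  ⟨1, covGroup.one_mem, by simp⟩

omit hp in
/-- The orbit is stable under the group. [folklore] -/
theorem image_mem_thetaOrbit {Φ : covShells.PacketAut} (hΦ : Φ ∈ covGroup) {j : toyIndex.Label} {vQ : toyIndex.VQ}
    {U : Set (covShells.Packet j vQ)} (hU : U ∈ thetaOrbit p j vQ) : Φ j vQ '' U ∈ thetaOrbit p j vQ := by
  obtain ⟨Ψ, hΨ, rfl⟩ := hU
  exact ⟨Φ * Ψ, covGroup.mul_mem hΦ hΨ, by rw [Set.image_image]; rfl⟩

omit hp in
/-- If a translate of the Θ-lattice is a ball, the Θ-lattice IS that ball (balls are fixed by the group). [folklore] -/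
theorem thetaLat_eq_of_image_eq_ball {Φ : covShells.PacketAut} (hΦ : Φ ∈ covGroup) {j : toyIndex.Label} {vQ : toyIndex.VQ} {d : ℕ}
    (h : Φ j vQ '' thetaLat p j vQ = ball p j vQ d) : thetaLat p j vQ = ball p j vQ d := by
  have h1 : (Φ j vQ).symm '' (Φ j vQ '' thetaLat p j vQ) = thetaLat p j vQ := by
    rw [Set.image_image]; simp
  rw [← h1, h]
  exact image_ball_of_mem_closure p (covGroup.inv_mem hΦ) j vQ d

/-- `j ≤ 2` for the labels of the bed (`l⋇ = 2`). [folklore] -/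
theorem label_le_two (j : toyIndex.Label) : (j : ℕ) ≤ 2 := Nat.lt_succ_iff.1 j.2

/-- If the Θ-lattice is a ball, the ball has depth `j²` (average depth `j²`, `sum_thetaDepth`). [folklore] -/
theorem eq_sq_of_thetaLat_eq_ball {j : toyIndex.Label} {vQ : toyIndex.VQ} {d : ℕ} (h : thetaLat p j vQ = ball p j vQ d) :
    d = (j : ℕ) ^ 2 := by
  have hle : ∀ c, thetaDepth j c = d := fun c => by
    apply le_antisymm
    · have hx : ((p : ℚ) ^ d) • ePt j vQ c ∈ thetaLat p j vQ := by
        rw [h]; exact (pow_smul_ePt_mem_glat_iff p vQ _ c d).2 le_rfl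
      exact (pow_smul_ePt_mem_glat_iff p vQ _ c d).1 hx
    · have hx : ((p : ℚ) ^ thetaDepth j c) • ePt j vQ c ∈ ball p j vQ d := by
        rw [← h]; exact (pow_smul_ePt_mem_glat_iff p vQ _ c _).2 le_rfl
      exact (pow_smul_ePt_mem_glat_iff p vQ _ c _).1 hx
  by_cases hj : j = 0
  · subst hj
    have := hle (czero 0)
    unfold thetaDepth at this
    simp at this
    simpa using this.symm
  · have hs := sum_thetaDepth (j := j) hj
    simp_rw [hle] at hs
    rw [Finset.sum_const, smul_eq_mul, Finset.card_univ, card_idx, mul_comm] at hs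
    exact Nat.eq_of_mul_eq_mul_right (pow_pos (by norm_num) _) hs

variable (j : toyIndex.Label) (vQ : toyIndex.VQ)

open scoped Classical in
/-- **The LOG-VOLUME of COV** at `(j, v_ℚ)` (Thm. 3.11 (i) (a) `μ^log`): `−j²` on the orbit of the Θ-lattice (minus its AVERAGE DEPTH over the
`2^{j+1}` coordinates, `sum_thetaDepth` — the honest normalised covolume of `q^{j²}·𝓘`), `−d` on the ball `p^d·𝓘`, `0` on the (inadmissible)
rest. MODEL DATA. [claim: Mochizuki2012, status: disputed] -/
def covVol (U : Set (covShells.Packet j vQ)) : ℝ :=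
  if U ∈ thetaOrbit p j vQ then -(((j : ℕ) : ℝ) ^ 2) else if h : ∃ d : ℕ, U = ball p j vQ d then -((Classical.choose h : ℕ) : ℝ) else 0

omit hp in
/-- `μ(translate of the Θ-lattice) = −j²`. [folklore] -/
theorem covVol_of_mem_thetaOrbit {U : Set (covShells.Packet j vQ)} (hU : U ∈ thetaOrbit p j vQ) :
    covVol p j vQ U = -(((j : ℕ) : ℝ) ^ 2) := by
  unfold covVol; rw [if_pos hU]

/-- `μ(p^d·𝓘) = −d`. [folklore] -/
theorem covVol_ball (d : ℕ) : covVol p j vQ (ball p j vQ d) = -(d : ℝ) := by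
  unfold covVol
  split_ifs with h1 h2
  · obtain ⟨Φ, hΦ, hΦ'⟩ := h1
    rw [eq_sq_of_thetaLat_eq_ball p (thetaLat_eq_of_image_eq_ball p hΦ hΦ'.symm)]
    push_cast; ring
  · have h3 := Classical.choose_spec h2
    rw [← (ball_eq_ball_iff p vQ d _).1 h3]
  · exact absurd ⟨d, rfl⟩ h2

omit hp in
/-- `μ(Θ-lattice) = −j²`. [folklore] -/
theorem covVol_thetaLat : covVol p j vQ (thetaLat p j vQ) = -(((j : ℕ) : ℝ) ^ 2) :=
  covVol_of_mem_thetaOrbit p j vQ (thetaLat_mem_thetaOrbit p j vQ)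

/-- `μ(q-ball) = −qDepth j` (`−1` at every nonzero label: label-INDEPENDENT q-volume). [folklore] -/
theorem covVol_qBall : covVol p j vQ (qBall p j vQ) = -(qDepth j : ℝ) := covVol_ball p j vQ _

/-- `j² ≤` the Θ-depth at the all-zero coordinate. [folklore] -/
theorem sq_le_thetaDepth_czero : (j : ℕ) ^ 2 ≤ thetaDepth j (czero j) := by
  unfold thetaDepth
  by_cases hj : j = 0
  · simp [hj]
  · rw [if_neg hj, if_pos rfl]
    have h2 := label_le_two j
    have h1 : 1 ≤ (j : ℕ) := Nat.one_le_iff_ne_zero.2 fun h => hj (Fin.ext h)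
    generalize (j : ℕ) = n at *
    interval_cases n <;> norm_num

/-- `qDepth j ≤ j²`. [folklore] -/
theorem qDepth_le_sq : qDepth j ≤ (j : ℕ) ^ 2 := by
  unfold qDepth
  split_ifs with hj
  · exact Nat.zero_le _
  · exact Nat.one_le_iff_ne_zero.2 (pow_ne_zero 2 fun h => hj (Fin.ext h))

/-- The updated coordinate `czero[0 ↦ 1]` has Θ-depth `qDepth j`. [folklore] -/
theorem thetaDepth_update : thetaDepth j (Function.update (czero j) 0 1) = qDepth j := by
  unfold thetaDepth qDepth
  by_cases hj : j = 0
  · simp [hj]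
  · rw [if_neg hj, if_neg hj, if_neg]
    intro h
    have h0 : (1 : Fin 2) = 0 := by simpa [czero] using congrFun h 0
    exact absurd h0 (by decide)

/-- If the Θ-lattice lies in a ball, that ball is at most as deep as the q-ball. [folklore] -/
theorem le_qDepth_of_thetaLat_subset {d : ℕ} (h : thetaLat p j vQ ⊆ ball p j vQ d) : d ≤ qDepth j := by
  have hx : ((p : ℚ) ^ qDepth j) • ePt j vQ (Function.update (czero j) 0 1) ∈ thetaLat p j vQ :=
    (pow_smul_ePt_mem_glat_iff p vQ _ _ _).2 (thetaDepth_update j).le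
  exact (pow_smul_ePt_mem_glat_iff p vQ _ _ _).1 (h hx)

/-- If a ball lies in the Θ-lattice, it is at least as deep as `thetaDepth czero ≥ j²`. [folklore] -/
theorem sq_le_of_ball_subset {d : ℕ} (h : ball p j vQ d ⊆ thetaLat p j vQ) : (j : ℕ) ^ 2 ≤ d := by
  have hx : ((p : ℚ) ^ d) • ePt j vQ (czero j) ∈ ball p j vQ d := (pow_smul_ePt_mem_glat_iff p vQ _ _ d).2 le_rfl
  exact (sq_le_thetaDepth_czero j).trans ((pow_smul_ePt_mem_glat_iff p vQ _ _ d).1 (h hx))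

/-- **The log-volume is MONOTONE on admissible regions** (balls and orbit members; Prop. 3.9 (i)). [folklore] -/
theorem covVol_mono {A B : Set (covShells.Packet j vQ)} (hA : (∃ d : ℕ, A = ball p j vQ d) ∨ A ∈ thetaOrbit p j vQ)
    (hB : (∃ d : ℕ, B = ball p j vQ d) ∨ B ∈ thetaOrbit p j vQ) (hAB : A ⊆ B) : covVol p j vQ A ≤ covVol p j vQ B := by
  rcases hA with ⟨d, rfl⟩ | hAo <;> rcases hB with ⟨d', rfl⟩ | hBo
  · rw [covVol_ball, covVol_ball]
    exact neg_le_neg (by exact_mod_cast (ball_subset_ball_iff p vQ d d').1 hAB)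
  · obtain ⟨Φ, hΦ, rfl⟩ := hBo
    rw [covVol_ball, covVol_of_mem_thetaOrbit p j vQ ⟨Φ, hΦ, rfl⟩]
    have h1 : ball p j vQ d ⊆ thetaLat p j vQ := by
      have h2 : (Φ j vQ).symm '' ball p j vQ d ⊆ (Φ j vQ).symm '' (Φ j vQ '' thetaLat p j vQ) := Set.image_mono hAB
      rw [Set.image_image] at h2
      simp only [LinearEquiv.symm_apply_apply, Set.image_id'] at h2
      rwa [show (Φ j vQ).symm '' ball p j vQ d = ball p j vQ d from image_ball_of_mem_closure p (covGroup.inv_mem hΦ) j vQ d] at h2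
    exact neg_le_neg (by exact_mod_cast sq_le_of_ball_subset p j vQ h1)
  · obtain ⟨Φ, hΦ, rfl⟩ := hAo
    rw [covVol_ball, covVol_of_mem_thetaOrbit p j vQ ⟨Φ, hΦ, rfl⟩]
    have h1 : thetaLat p j vQ ⊆ ball p j vQ d' := by
      intro x hx
      have h2 : Φ j vQ x ∈ ball p j vQ d' := hAB ⟨x, hx, rfl⟩
      rw [← image_ball_of_mem_closure p hΦ j vQ d'] at h2
      obtain ⟨y, hy, hxy⟩ := h2
      rwa [← (Φ j vQ).injective hxy]
    have h3 := (le_qDepth_of_thetaLat_subset p j vQ h1).trans (qDepth_le_sq j)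
    exact neg_le_neg (by exact_mod_cast h3)
  · rw [covVol_of_mem_thetaOrbit p j vQ hAo, covVol_of_mem_thetaOrbit p j vQ hBo]

end CoveringWitness

end Summit.ABC.IUTFork.Cor312Vol

end
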